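import Literature.NumberTheory.Automorphic.BianchiCuspStabilizer
import Literature.NumberTheory.Automorphic.BianchiLocalFiniteness
import HarnessLib

/-!
# Finiteness of the cusp stabiliser elements with bounded translation part

Topic `NumberTheory/Automorphic`; namespace `Literature.NumberTheory.Automorphic`, grouping
sub-namespace `BianchiCusp`.  Theorems only; sequel of `BianchiCuspStabilizer`.

With the notation of `BianchiCuspStabilizer` (`u ≠ 0` integral, `g_u = (a c; b d)`,
`m = g_u⁻¹ σ(π) g_u = (m₀₀ m₀₁; 0 m₁₁)` for `π ∈ Γ = GL₂(𝓞_K)` fixing the cusp `u`):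

* `toGL_zero_one_eq`, `toGL_one_zero_eq` — `σ(π₀₁) = a² m₀₁ + a c (m₁₁ - m₀₀)`,
  `σ(π₁₀) = -b² m₀₁ + b d (m₀₀ - m₁₁)`;
* `toGL_injective`;
* `finite_parabolic_of_hcoord_le` — **for every `R`, the set of `π ∈ Γ` fixing the cusp `u` for
  which some `H` in the cone has `|w_u(H)| ≤ R` and `|w_u(π • H)| ≤ R` is finite**: such `π` have
  `|m₀₁| ≤ 2R` (`norm_conjElt_zero_one_le`), hence bounded `σ`-images of `π u`, `det π`, `π₀₁`,
  `π₁₀` — finitely many values by the discreteness of `σ(𝓞_K)`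
  (`ImaginaryQuadratic.finite_setOf_norm_le`) — and these entries determine `m`, hence `π`;
* `finite_gamma_cusp` — **for compact `C ⊆ 𝒫`, a cusp `u` and `δ`, only finitely many `γ ∈ Γ`
  move some point of `C` into `{depth_u < 1, |w_u| ≤ δ}`** (the cusps of depth `< 1` on `C` lie
  on finitely many lines, `exists_finite_lines` of `BianchiLocalFiniteness`, and the previous
  statement applied to `γ_f γ⁻¹`).

This is the proper discontinuity of the action of the stabiliser `Γ_u` on the horosphere at
the cusp ([ElstrodtGrunewaldMennicke1998, Ch. 2 §2.3, Ch. 7 §7.3]; [Swan1971, §3]), in the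
quantitative form consumed by the local finiteness of the cover of the cone by cusp boxes.

## References

* J. Elstrodt, F. Grunewald, J. Mennicke, *Groups Acting on Hyperbolic Space* (1998), Ch. 2
  §2.3, Ch. 7 §7.3 [ElstrodtGrunewaldMennicke1998].
* R. G. Swan, Adv. Math. 6 (1971), §3 [Swan1971].
-/

noncomputable section

open Matrix Complex NumberField
open scoped MatrixGroups ComplexConjugate

namespace Literature.NumberTheory.Automorphic

namespace BianchiCusp

open BianchiCone Literature.NumberTheory.NumberFields

variable {K : Type*} [Field K] [NumberField K] (σ : K →+* ℂ)

/-- `toGL σ` is injective. [folklore] -/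
theorem toGL_injective : Function.Injective (toGL σ : GL (Fin 2) (𝓞 K) → GL (Fin 2) ℂ) := by
  intro π π' h
  apply Units.ext
  refine Matrix.ext fun i j => ?_
  have hij := congrArg (fun g : GL (Fin 2) ℂ => (g : Mat) i j) h
  simp only [toGL_apply] at hij
  exact IsFractionRing.injective (𝓞 K) K (σ.injective hij)

omit [NumberField K] in
/-- `det σ(π) = σ(det π)`. [folklore] -/
theorem det_toGL (π : GL (Fin 2) (𝓞 K)) :
    (toGL σ π : Mat).det = σ (((π : Matrix (Fin 2) (Fin 2) (𝓞 K)).det : 𝓞 K) : K) := by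
  rw [show (toGL σ π : Mat) = (σ.comp (algebraMap (𝓞 K) K)).mapMatrix (π : Matrix (Fin 2) (Fin 2) (𝓞 K)) from rfl,
    ← RingHom.map_det]
  rfl

section Parabolic

variable {u : OVec K} (hu : u ≠ 0)

/-- `det m = σ(det π)`. [folklore] -/
theorem det_conjElt (π : GL (Fin 2) (𝓞 K)) :
    (conjElt σ hu π : Mat).det = σ (((π : Matrix (Fin 2) (Fin 2) (𝓞 K)).det : 𝓞 K) : K) := by
  rw [conjElt, Units.val_mul, Units.val_mul, det_mul, det_mul, det_toGL, mul_comm, ← mul_assoc,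
    ← det_mul, coe_mul_inv, det_one, one_mul]

/-- **`σ(π₀₁) = a² m₀₁ + a c (m₁₁ - m₀₀)`.** [cite: ElstrodtGrunewaldMennicke1998, Ch. 7 §7.3] -/
theorem toGL_zero_one_eq (π : GL (Fin 2) (𝓞 K)) (h10 : (conjElt σ hu π : Mat) 1 0 = 0) :
    (toGL σ π : Mat) 0 1 = σ (u 0 : K) ^ 2 * (conjElt σ hu π : Mat) 0 1 +
      σ (u 0 : K) * σ (compl hu).1 * ((conjElt σ hu π : Mat) 1 1 - (conjElt σ hu π : Mat) 0 0) := by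
  rw [toGL_eq_conj σ hu π, Units.val_mul, Units.val_mul, coe_cuspGL, coe_cuspGL_inv]
  simp [Matrix.mul_apply, Matrix.vecMul, dotProduct, Fin.sum_univ_two, h10]
  ring

/-- **`σ(π₁₀) = -b² m₀₁ + b d (m₀₀ - m₁₁)`.** [cite: ElstrodtGrunewaldMennicke1998, Ch. 7 §7.3] -/
theorem toGL_one_zero_eq (π : GL (Fin 2) (𝓞 K)) (h10 : (conjElt σ hu π : Mat) 1 0 = 0) :
    (toGL σ π : Mat) 1 0 = -(σ (u 1 : K) ^ 2) * (conjElt σ hu π : Mat) 0 1 +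
      σ (u 1 : K) * σ (compl hu).2 * ((conjElt σ hu π : Mat) 0 0 - (conjElt σ hu π : Mat) 1 1) := by
  rw [toGL_eq_conj σ hu π, Units.val_mul, Units.val_mul, coe_cuspGL, coe_cuspGL_inv]
  simp [Matrix.mul_apply, Matrix.vecMul, dotProduct, Fin.sum_univ_two, h10]
  ring

/-- **Finiteness of the cusp stabiliser elements moving a point with bounded horizontal
coordinate to a point with bounded horizontal coordinate.** [cite: ElstrodtGrunewaldMennicke1998, Ch. 7 §7.3] -/
theorem finite_parabolic_of_hcoord_le [IsTotallyComplex K] (hK : Module.finrank ℚ K = 2) (R : ℝ) :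
    {π : GL (Fin 2) (𝓞 K) |
      ((π : Matrix (Fin 2) (Fin 2) (𝓞 K)) *ᵥ u) 0 * u 1 - ((π : Matrix (Fin 2) (Fin 2) (𝓞 K)) *ᵥ u) 1 * u 0 = 0 ∧
      ∃ H ∈ cone, ‖hcoord σ hu H‖ ≤ R ∧ ‖hcoord σ hu (act (toGL σ π) H)‖ ≤ R}.Finite := by
  set S := {π : GL (Fin 2) (𝓞 K) |
      ((π : Matrix (Fin 2) (Fin 2) (𝓞 K)) *ᵥ u) 0 * u 1 - ((π : Matrix (Fin 2) (Fin 2) (𝓞 K)) *ᵥ u) 1 * u 0 = 0 ∧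
      ∃ H ∈ cone, ‖hcoord σ hu H‖ ≤ R ∧ ‖hcoord σ hu (act (toGL σ π) H)‖ ≤ R} with hS
  -- the invariants
  let Φ : GL (Fin 2) (𝓞 K) → OVec K × 𝓞 K × 𝓞 K × 𝓞 K := fun π =>
    ((π : Matrix (Fin 2) (Fin 2) (𝓞 K)) *ᵥ u, (π : Matrix (Fin 2) (Fin 2) (𝓞 K)).det,
      (π : Matrix (Fin 2) (Fin 2) (𝓞 K)) 0 1, (π : Matrix (Fin 2) (Fin 2) (𝓞 K)) 1 0)
  set a : ℂ := σ (u 0 : K)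
  set b : ℂ := σ (u 1 : K)
  set c : ℂ := σ (compl hu).1
  set d : ℂ := σ (compl hu).2
  -- finite target
  let F₁ : Set (OVec K) := Set.pi Set.univ fun i => {x : 𝓞 K | ‖σ (x : K)‖ ≤ ‖σ (u i : K)‖}
  let F₂ : Set (𝓞 K) := {x | ‖σ (x : K)‖ ≤ 1}
  let F₃ : Set (𝓞 K) := {x | ‖σ (x : K)‖ ≤ ‖a‖ ^ 2 * (2 * R) + ‖a‖ * ‖c‖ * 2}
  let F₄ : Set (𝓞 K) := {x | ‖σ (x : K)‖ ≤ ‖b‖ ^ 2 * (2 * R) + ‖b‖ * ‖d‖ * 2}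
  have hF : (F₁ ×ˢ F₂ ×ˢ F₃ ×ˢ F₄).Finite := by
    refine Set.Finite.prod (Set.Finite.pi fun i => ?_) (Set.Finite.prod ?_ (Set.Finite.prod ?_ ?_))
    · exact ImaginaryQuadratic.finite_setOf_norm_le hK σ _
    · exact ImaginaryQuadratic.finite_setOf_norm_le hK σ _
    · exact ImaginaryQuadratic.finite_setOf_norm_le hK σ _
    · exact ImaginaryQuadratic.finite_setOf_norm_le hK σ _
  -- the image lies in the finite target
  have himage : Φ '' S ⊆ F₁ ×ˢ F₂ ×ˢ F₃ ×ˢ F₄ := by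
    rintro _ ⟨π, ⟨hpar, H, hH, h1, h2⟩, rfl⟩
    obtain ⟨μ, hμ⟩ := exists_mulVec_eq_smul hu _ hpar
    obtain ⟨h00, h10⟩ := conjElt_col_zero σ hu π hμ
    obtain ⟨hn00, hn11⟩ := norm_conjElt_diag σ hu hK π hμ
    have hμ1 : ‖σ μ‖ = 1 := norm_eq_one_of_mulVec_eq_smul σ hK hu π hμ
    have hm01 := norm_conjElt_zero_one_le σ hu hK π hμ hH h1 h2
    have hdiff : ‖(conjElt σ hu π : Mat) 1 1 - (conjElt σ hu π : Mat) 0 0‖ ≤ 2 :=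
      (norm_sub_le _ _).trans (by rw [hn11, hn00]; norm_num)
    have hdiff' : ‖(conjElt σ hu π : Mat) 0 0 - (conjElt σ hu π : Mat) 1 1‖ ≤ 2 :=
      (norm_sub_le _ _).trans (by rw [hn11, hn00]; norm_num)
    have hR : 0 ≤ R := (norm_nonneg _).trans h1
    refine ⟨?_, ?_, ?_, ?_⟩
    · intro i _
      change ‖σ ((((π : Matrix (Fin 2) (Fin 2) (𝓞 K)) *ᵥ u) i : 𝓞 K) : K)‖ ≤ ‖σ (u i : K)‖
      rw [hμ i, map_mul, norm_mul, hμ1, one_mul]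
    · change ‖σ ((((π : Matrix (Fin 2) (Fin 2) (𝓞 K)).det : 𝓞 K) : K))‖ ≤ 1
      exact (ImaginaryQuadratic.norm_eq_one_of_isUnit hK σ (Matrix.isUnits_det_units π)).le
    · change ‖σ (((π : Matrix (Fin 2) (Fin 2) (𝓞 K)) 0 1 : 𝓞 K) : K)‖ ≤ ‖a‖ ^ 2 * (2 * R) + ‖a‖ * ‖c‖ * 2
      have he := toGL_zero_one_eq σ hu π h10
      rw [toGL_apply] at he
      rw [RingOfIntegers.coe_eq_algebraMap, show σ ((algebraMap (𝓞 K) K) ((π : Matrix (Fin 2) (Fin 2) (𝓞 K)) 0 1)) = _ from he]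
      calc ‖σ (u 0 : K) ^ 2 * (conjElt σ hu π : Mat) 0 1 +
            σ (u 0 : K) * σ (compl hu).1 * ((conjElt σ hu π : Mat) 1 1 - (conjElt σ hu π : Mat) 0 0)‖
          ≤ ‖σ (u 0 : K) ^ 2 * (conjElt σ hu π : Mat) 0 1‖ +
            ‖σ (u 0 : K) * σ (compl hu).1 * ((conjElt σ hu π : Mat) 1 1 - (conjElt σ hu π : Mat) 0 0)‖ :=
            norm_add_le _ _
        _ ≤ ‖a‖ ^ 2 * (2 * R) + ‖a‖ * ‖c‖ * 2 := by
            rw [norm_mul, norm_mul, norm_mul, norm_pow]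
            exact add_le_add (mul_le_mul_of_nonneg_left hm01 (by positivity))
              (mul_le_mul_of_nonneg_left hdiff (by positivity))
    · change ‖σ (((π : Matrix (Fin 2) (Fin 2) (𝓞 K)) 1 0 : 𝓞 K) : K)‖ ≤ ‖b‖ ^ 2 * (2 * R) + ‖b‖ * ‖d‖ * 2
      have he := toGL_one_zero_eq σ hu π h10
      rw [toGL_apply] at he
      rw [RingOfIntegers.coe_eq_algebraMap, show σ ((algebraMap (𝓞 K) K) ((π : Matrix (Fin 2) (Fin 2) (𝓞 K)) 1 0)) = _ from he]
      calc ‖-(σ (u 1 : K) ^ 2) * (conjElt σ hu π : Mat) 0 1 +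
            σ (u 1 : K) * σ (compl hu).2 * ((conjElt σ hu π : Mat) 0 0 - (conjElt σ hu π : Mat) 1 1)‖
          ≤ ‖-(σ (u 1 : K) ^ 2) * (conjElt σ hu π : Mat) 0 1‖ +
            ‖σ (u 1 : K) * σ (compl hu).2 * ((conjElt σ hu π : Mat) 0 0 - (conjElt σ hu π : Mat) 1 1)‖ :=
            norm_add_le _ _
        _ ≤ ‖b‖ ^ 2 * (2 * R) + ‖b‖ * ‖d‖ * 2 := by
            rw [norm_mul, norm_mul, norm_mul, norm_neg, norm_pow]
            exact add_le_add (mul_le_mul_of_nonneg_left hm01 (by positivity))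
              (mul_le_mul_of_nonneg_left hdiff' (by positivity))
  -- injectivity
  have hinj : Set.InjOn Φ S := by
    rintro π ⟨hpar, -⟩ π' ⟨hpar', -⟩ hΦ
    simp only [Φ, Prod.mk.injEq] at hΦ
    obtain ⟨hv, hdet, h01, h10e⟩ := hΦ
    obtain ⟨μ, hμ⟩ := exists_mulVec_eq_smul hu _ hpar
    obtain ⟨μ', hμ'⟩ := exists_mulVec_eq_smul hu _ hpar'
    -- `μ = μ'`
    have hμμ : μ = μ' := by
      have hi : ∃ i, u i ≠ 0 := by
        by_contra hc
        apply hu; funext i; by_contra hi; exact hc ⟨i, hi⟩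
      obtain ⟨i, hi⟩ := hi
      have hi' : ((u i : 𝓞 K) : K) ≠ 0 := by
        rw [Ne, RingOfIntegers.coe_eq_algebraMap, map_eq_zero_iff _ (IsFractionRing.injective (𝓞 K) K)]
        exact hi
      have := hμ i
      rw [hv, hμ' i] at this
      exact (mul_left_inj' hi').1 this.symm
    subst hμμ
    obtain ⟨m00, m10⟩ := conjElt_col_zero σ hu π hμ
    obtain ⟨m00', m10'⟩ := conjElt_col_zero σ hu π' hμ'
    have hμ0 : σ μ ≠ 0 := by
      rw [← m00]
      intro h0
      have := norm_conjElt_diag σ hu hK π hμ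
      rw [h0, norm_zero] at this
      exact zero_ne_one this.1
    -- `m₁₁ = m₁₁'`
    have h11 : (conjElt σ hu π : Mat) 1 1 = (conjElt σ hu π' : Mat) 1 1 := by
      have hd := det_conjElt σ hu π
      have hd' := det_conjElt σ hu π'
      rw [det_fin_two, m10, mul_zero, sub_zero, m00] at hd
      rw [det_fin_two, m10', mul_zero, sub_zero, m00', ← hdet, ← hd] at hd'
      exact (mul_right_inj' hμ0).1 hd'.symm
    -- `m₀₁ = m₀₁'`
    have h01m : (conjElt σ hu π : Mat) 0 1 = (conjElt σ hu π' : Mat) 0 1 := by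
      by_cases ha : u 0 = 0
      · have hb : u 1 ≠ 0 := by
          intro hb; apply hu; funext i; fin_cases i; exact ha; exact hb
        have hb' : σ (u 1 : K) ≠ 0 := by
          rw [Ne, map_eq_zero, RingOfIntegers.coe_eq_algebraMap, map_eq_zero_iff _ (IsFractionRing.injective (𝓞 K) K)]
          exact hb
        have e := toGL_one_zero_eq σ hu π m10
        have e' := toGL_one_zero_eq σ hu π' m10'
        rw [toGL_apply, h10e, ← toGL_apply σ π', e', m00, m00', h11] at e
        have : -(σ (u 1 : K) ^ 2) * (conjElt σ hu π' : Mat) 0 1 = -(σ (u 1 : K) ^ 2) * (conjElt σ hu π : Mat) 0 1 := by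
          linear_combination e
        exact ((mul_right_inj' (neg_ne_zero.2 (pow_ne_zero 2 hb'))).1 this).symm
      · have ha' : σ (u 0 : K) ≠ 0 := by
          rw [Ne, map_eq_zero, RingOfIntegers.coe_eq_algebraMap, map_eq_zero_iff _ (IsFractionRing.injective (𝓞 K) K)]
          exact ha
        have e := toGL_zero_one_eq σ hu π m10
        have e' := toGL_zero_one_eq σ hu π' m10'
        rw [toGL_apply, h01, ← toGL_apply σ π', e', m00, m00', h11] at e
        have : σ (u 0 : K) ^ 2 * (conjElt σ hu π' : Mat) 0 1 = σ (u 0 : K) ^ 2 * (conjElt σ hu π : Mat) 0 1 := by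
          linear_combination e
        exact ((mul_right_inj' (pow_ne_zero 2 ha')).1 this).symm
    -- conclude
    have hm : conjElt σ hu π = conjElt σ hu π' := by
      apply Units.ext
      ext i j
      fin_cases i <;> fin_cases j
      · exact m00.trans m00'.symm
      · exact h01m
      · exact m10.trans m10'.symm
      · exact h11
    apply toGL_injective σ
    rw [toGL_eq_conj σ hu π, toGL_eq_conj σ hu π', hm]
  exact Set.Finite.of_finite_image (hF.subset himage) hinj

end Parabolic

/-- **Only finitely many `γ` move a point of a compact set into a cusp box.**
[cite: ElstrodtGrunewaldMennicke1998, Ch. 7 §7.3] -/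
theorem finite_gamma_cusp [IsTotallyComplex K] (hK : Module.finrank ℚ K = 2) {u : OVec K} (hu : u ≠ 0)
    {C : Set Mat} (hC : IsCompact C) (hCc : C ⊆ cone) (δ : ℝ) :
    {γ : GL (Fin 2) (𝓞 K) | ∃ M ∈ C, depth σ u (act (toGL σ γ) M) < 1 ∧
      ‖hcoord σ hu (act (toGL σ γ) M)‖ ≤ δ}.Finite := by
  classical
  obtain ⟨F, hFfin, hF0, hF⟩ := exists_finite_lines σ hK hC hCc
  set Sset := {γ : GL (Fin 2) (𝓞 K) | ∃ M ∈ C, depth σ u (act (toGL σ γ) M) < 1 ∧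
      ‖hcoord σ hu (act (toGL σ γ) M)‖ ≤ δ} with hSset
  let A : OVec K → Set (GL (Fin 2) (𝓞 K)) := fun f =>
    {γ ∈ Sset | (((γ⁻¹ : GL (Fin 2) (𝓞 K)) : Matrix (Fin 2) (Fin 2) (𝓞 K)) *ᵥ u) 0 * f 1 -
      (((γ⁻¹ : GL (Fin 2) (𝓞 K)) : Matrix (Fin 2) (Fin 2) (𝓞 K)) *ᵥ u) 1 * f 0 = 0}
  -- `Sset ⊆ ⋃_{f ∈ F} A f`
  have hcover : Sset ⊆ ⋃ f ∈ F, A f := by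
    rintro γ ⟨M, hM, hd, hw⟩
    have hγu : ((γ⁻¹ : GL (Fin 2) (𝓞 K)) : Matrix (Fin 2) (Fin 2) (𝓞 K)) *ᵥ u ≠ 0 := by
      intro h0
      have := congrArg (fun z => ((γ : GL (Fin 2) (𝓞 K)) : Matrix (Fin 2) (Fin 2) (𝓞 K)) *ᵥ z) h0
      simp only [mulVec_mulVec, ← Units.val_mul, mul_inv_cancel, Units.val_one, one_mulVec, mulVec_zero] at this
      exact hu this
    rw [depth_act_eq σ hK γ u (hCc hM).1] at hd
    obtain ⟨f, hfF, hpar⟩ := hF _ hγu ⟨M, hM, hd⟩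
    exact Set.mem_iUnion₂.2 ⟨f, hfF, ⟨M, hM, by rwa [depth_act_eq σ hK γ u (hCc hM).1], hw⟩, hpar⟩
  refine Set.Finite.subset (Set.Finite.biUnion hFfin fun f hfF => ?_) hcover
  -- each `A f` is finite
  rcases (A f).eq_empty_or_nonempty with he | ⟨γ₀, ⟨M₀, hM₀, -, -⟩, hγ₀⟩
  · rw [he]; exact Set.finite_empty
  -- bound for `hcoord` after `γ₀` on `C`
  have hcont : ContinuousOn (fun M : Mat => hcoord σ hu (act (toGL σ γ₀) M)) C :=
    (continuousOn_hcoord σ hu).comp (continuous_act _).continuousOn fun M hM => act_mem_cone _ (hCc hM)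
  obtain ⟨R₀, hR₀⟩ := hC.exists_bound_of_continuousOn hcont
  set R := max δ R₀ with hR
  have hP := finite_parabolic_of_hcoord_le σ hu hK R
  refine Set.Finite.subset (Set.Finite.preimage (f := fun γ : GL (Fin 2) (𝓞 K) => γ * γ₀⁻¹) ?_ hP) ?_
  · intro γ _ γ' _ h
    exact mul_right_cancel h
  rintro γ ⟨⟨M, hM, hd, hw⟩, hpar⟩
  have hMc := hCc hM
  -- `ψ = γ γ₀⁻¹` fixes the cusp `u`
  have hpar2 := det2o_trans (hF0 f hfF) hpar hγ₀
  have hψ : ((((γ * γ₀⁻¹ : GL (Fin 2) (𝓞 K)) : Matrix (Fin 2) (Fin 2) (𝓞 K)) *ᵥ u) 0 * u 1 -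
      (((γ * γ₀⁻¹ : GL (Fin 2) (𝓞 K)) : Matrix (Fin 2) (Fin 2) (𝓞 K)) *ᵥ u) 1 * u 0) = 0 := by
    have h := det2o_mulVec ((γ : GL (Fin 2) (𝓞 K)) : Matrix (Fin 2) (Fin 2) (𝓞 K))
      (((γ⁻¹ : GL (Fin 2) (𝓞 K)) : Matrix (Fin 2) (Fin 2) (𝓞 K)) *ᵥ u)
      (((γ₀⁻¹ : GL (Fin 2) (𝓞 K)) : Matrix (Fin 2) (Fin 2) (𝓞 K)) *ᵥ u)
    rw [hpar2, mul_zero, mulVec_mulVec, mulVec_mulVec, ← Units.val_mul, ← Units.val_mul, mul_inv_cancel,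
      Units.val_one, one_mulVec] at h
    linear_combination -h
  refine ⟨hψ, act (toGL σ γ₀) M, act_mem_cone _ hMc, (hR₀ M hM).trans (le_max_right _ _), ?_⟩
  rw [map_mul, map_inv, act_mul, ← act_mul (toGL σ γ₀)⁻¹ (toGL σ γ₀) M, inv_mul_cancel, act_one]
  exact hw.trans (le_max_left _ _)

end BianchiCusp

end Literature.NumberTheory.Automorphic
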